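/-
Copyright (c) 2026 the pub-hodgecm-mathlib formalisation cell (harness21).  Prover seat hodgecm-mathlib-LH4-p12 (g8), req620 Track A «(D-RAM) FOUR-FRAME» squad
((β₂) road (R-36), LANE C (RamM): the (OFF_C) dispatch ED. 1-C of ‹OFF_C.letter.v2› — lane-C hinge LH7-p10 (g2) «=» 2026-09-05T00:08:32Z), 2026-09-05.
-/
import Summits.HodgeConjecture.HodgeConjecture.Theorems.F0P3cDyRamBeta2ConesOffRowOfPiecesParity   -- ★ p863163 (this seat): brings ★ p862671 FAR∕HIGH, ★ p862962 HIGH′, the block-frame vocabulary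
import Summits.HodgeConjecture.HodgeConjecture.Theorems.F0P3cDyRamConeCellPresentationLevel        -- ★ p863162 (this seat): the DEEP fold at level `ℓ₀`, the ANTI-DIAGONAL fold (datum-free)
import Summits.HodgeConjecture.HodgeConjecture.Theorems.F0P3cDyRamConeCellEmptyAtlas               -- ★ (LH7-p10 lineage): §RamM `levelSet_eq_empty_of_lt_ramM ∕ _of_shallow_ramM ∕ _of_odd_ramM`
import Summits.HodgeConjecture.HodgeConjecture.Theorems.F0P3cDyRamFrameRamMLetters                 -- ★ (LH4-p04 (g5)): `levelSet_eq_of_mul_sub_map_eq` (the `α ↦ ϖM` transport, a `rw` by `_c6`)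
import Summits.HodgeConjecture.HodgeConjecture.Theorems.F0P3cDyRamClassLettersRamM                 -- ★ (LH4 lineage): `exists_half_order_add` (`vh + dρ = 2e`)
import Summits.HodgeConjecture.HodgeConjecture.Theorems.F0P3cDyRamResidueFieldEvenCard              -- ★ p858326 (LH4-p06): `two_dvd_natCard_residueField_of_v_two_lt_one`
import HarnessLib

/-!
# Crux `H413`, line LH4 «(D-RAM) FOUR-FRAME» — STAGE-1b, row (2) of `f_{T₊}`, the (β₂) road «PURE-CELL LEDGER» (R-36), LANE C (RamM): ED. 1-C —
# THE DISPATCH OF `OFF_C.letter.v2` («OFF THE LIVE ROW `4b + 2ℓ₀ = m` EVERY RamM CONE CELL CONTRIBUTES ZERO») FROM ITS PIECES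

Cell `hodgecm-mathlib` (D-0151), FLOOR 0, crux item H413 = `stmt-HodgeConjecture-24833`, route of record `HCCMUnconditional`; squads F0∕P3c∕LH4 ∕ LH7; lane
`--supports stmt-HodgeConjecture-24833 --as helper` (count-neutral; pays NO tier-0 row).  THEOREMS ONLY (no `def`, no instance, no notation, no `sorry`, default heartbeats);
★-only imports; states NO law; the four sockets, (OFF_C), (ROW_C) and (β₂) stay HYPOTHESES.  ONE literal in ★ p861305 §3's general-block spelling, LANE-C block (`_hC`, `_c1 … _c29`).

WHAT (lane-C hinge LH7-p10 (g2) 2026-09-05T00:03:22Z: «open leaves of lane C = ‹OFF_C.v2› + ‹ROW_C.v2› ONLY»; 00:08:32Z «=» on this dispatch and its weights; consumer ★ p863158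
`…Beta2ConesCOfRows.beta2ConesC_of_rows (N) (hoff : ‹OFF_C.letter.v2›) (hrow)`).  `OFF_C.letter.v2` (`F0/P3c/LH7/LH7-p10/g2/OFF_C.letter.v2.LH7p10g2.lean.txt` a2c0234d7b04450d) is
lane B's `OFF.letter` with the RamM block and the live row `4 * b + 2 * (d % 2) ≠ m`.  LANE-C WEIGHTS (all read off the letters): `|jE ϖ| = exp(−2)` (`_c1` + `|ϖ| = exp(−1)`),
`|α − ρα| = |ϖM − ρϖM| = exp(−dρ)` (`_c6`, `_c7`, `_c5`), so `|jE ϖ^j·(α − ρα)| = exp(−(2j + dρ))`; `|μ| = exp(−m)`, `|μ − ρμ| = exp(−jl)` with `μ = lam − jE u₀₀`; IN THIS FILE: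
`jl ≡ dρ (mod 2)` (`(μ − ρμ)∕(α − ρα)` is `ρ`-fixed, `_c7`'s even-order clause) and `m + dρ ≤ jl` (`_hint` at `μ∕jEϖ^{m∕2}`, `m` even).  In E-units `m = 2m_E`, `jl = 2jl_E + dρ` the
region geometry is lane B's: live row `2b + ℓ₀ = m_E`, lower line `j + b + ℓ₀ = jl_E`, top line `j + m_E = jl_E + b`.
THIS FILE is the lane-C twin of ★ ED. 4∕5 (`…OffRowOfPiecesParity`, `…OffRowOfPiecesResidual`): binders = the fence schedule `N : ℕ → ℕ → ℕ`, `OFF_C.letter.v2`'s binder block BYTE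
FOR BYTE, the parity letter `hparC : m % 2 = 0` (LH4-p16 (g2)'s rider; F0P3-p01 (g37) 23:24:33Z numerics), then THREE sockets over the bound names (each carrying the live-class
premise `j + 1 = b + s0 ∨ (b + s0 ≤ j ∧ (j − b − s0) even)` of ★ atlas §RamM): `hEvenRowC` (odd `d` only: the cells `m = 4b` — the even-parity row, off the live row `4b + 2`;
vacuous if the rider gives `m ≡ 2 (mod 4)` there), `hTopC` (THE TOP LINE `jl + 2b = 2j + dρ + m`, `m < 4b`, `b ≤ j`, every band — no lane-C top head exists), `hLowC` (THE LOWER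
LINE `jl = 2j + dρ + 2b + 2ℓ₀`, `4b + 2ℓ₀ < m`, `b < j`); conclusion = `OFF_C.letter.v2`'s body VERBATIM.  FOLDED BY NAME (valuation-letter lemmas with lane-C arithmetic):
(E0)_C `j < b` ★ `levelSet_eq_empty_of_lt_ramM`, SHALLOW `j + 1 < b + s0` ★ `…_of_shallow_ramM`, ODD CLASS ★ `…_of_odd_ramM` (all at the datum uniformiser `ϖM`, moved to
`α` by ★ `levelSet_eq_of_mul_sub_map_eq` — a `rw` by `_c6`; plumbing `2 ∣ #𝓀[M]` ★ `two_dvd_natCard_residueField_of_v_two_lt_one`, `vh + dρ = 2e` ★ `exists_half_order_add`);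
FAR ★ p862671 `levelSetDep_eq_empty_of_far` (`b < j`, `jl + 2b < 2j + dρ + m`, `jl < 2j + dρ + 2b`); HIGH′ ★ p862962 `levelSetDep_eq_empty_of_high'` (`b ≤ j`, `m < 4b`,
`2j + dρ + m < jl + 2b`); DEEP ★ p863162 `levelSetDep_inter_shell_eq_empty_of_deep_level` at both shells (`b ≤ j`, `4b + 2ℓ₀ + 2 ≤ m`, `2j + dρ + 2b + 2ℓ₀ + 2 ≤ jl`); the
LEVEL-0 STRIP at odd `d` (`jl = 2j + dρ + 2b`, `4b + 4 ≤ m`, `b < j`) ★ `levelSetDep_inter_shell_eq_empty_of_antidiagonal_one`.  Proof = the exhaustive `omega` case split.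
HONEST LABEL.  Count-neutral dispatch; nothing printed is asserted; no census law is stated; `hparC`, the three sockets, (OFF_C), (ROW_C) and (β₂) stay HYPOTHESES; `HC_CM` is proved
only modulo the 7 printed citations (2 remaining named inputs: hLiu418 = `stmt-HodgeConjecture-24832`, h413 = `stmt-HodgeConjecture-24833`) until rung 0 closes.
## References
* [Kottwitz1986BaseChangeUnits] R. E. Kottwitz, *Base change for unit elements of Hecke algebras*, Compositio Math. 60 (1986): §1 pp. 240–241 (signed lattice counts, cell by cell).
* [Jacobowitz1962] R. Jacobowitz, *Hermitian forms over local fields*, Amer. J. Math. 84 (1962): §4 (hermitian lattices over orders; Gram-primitivity).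
* [Flicker1998UnitaryFL] Y. Flicker, Prop. 7 p. 84 (the ramified-M order census rows).
* [Serre1979] J.-P. Serre, *Local Fields*, GTM 67 (1979): Ch. III §6 Prop. 12 (orders), Ch. V §3 (ramified quadratic norms).
-/

set_option autoImplicit false

noncomputable section

namespace Summit.HodgeConjecture.HodgeConjecture.Cruxes.H413.F0P3cDyRamBeta2ConesOffRowCOfPieces

open scoped Valued WithZero Matrix MatrixGroups Pointwise Classical
open WithZero
open Literature.NumberTheory.Automorphic Literature.NumberTheory.Automorphic.HermitianLattice Literature.NumberTheory.Automorphic.UnitaryLatticeTree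
open Literature.NumberTheory.Automorphic.UnitaryThreeFourFrame (IsRamifiedQuadraticDatum)
open Literature.NumberTheory.Rogawski1990
open Summit.HodgeConjecture.HodgeConjecture.Cruxes.H413.F0P3cDyRamFourFramePieces
open Summit.HodgeConjecture.HodgeConjecture.Cruxes.H413.F0P3cDyRamFourFrameCensusDefs (LatticeInLevel LatticeNearTransvShell)
open Summit.HodgeConjecture.HodgeConjecture.Cruxes.H413.F0P3cDyRamStageOneBDefs (mcOfRecord mstarOfRecord_le_mcOfRecord)
open Summit.HodgeConjecture.HodgeConjecture.Cruxes.H413.F0P3cDyRamToricCensusDefs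
open Summit.HodgeConjecture.HodgeConjecture.Cruxes.H413.F0P3cDyRamFarConeCellEmpty (levelSetDep_eq_empty_of_far)
open Summit.HodgeConjecture.HodgeConjecture.Cruxes.H413.F0P3cDyRamDiagonalConeCellEmpty (levelSetDep_eq_empty_of_high')
open Summit.HodgeConjecture.HodgeConjecture.Cruxes.H413.F0P3cDyRamConeCellPresentationLevel (levelSetDep_inter_shell_eq_empty_of_deep_level levelSetDep_inter_shell_eq_empty_of_antidiagonal_one)
open Summit.HodgeConjecture.HodgeConjecture.Cruxes.H413.F0P3cDyRamConeCellEmptyAtlas (levelSet_eq_empty_of_lt_ramM levelSet_eq_empty_of_shallow_ramM levelSet_eq_empty_of_odd_ramM)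
open Summit.HodgeConjecture.HodgeConjecture.Cruxes.H413.F0P3cDyRamFrameRamMLetters (levelSet_eq_of_mul_sub_map_eq)
open Summit.HodgeConjecture.HodgeConjecture.Cruxes.H413.F0P3cDyRamClassLettersRamM (exists_half_order_add)
open Summit.HodgeConjecture.HodgeConjecture.Cruxes.H413.F0P3cDyRamToricLevelCensusRamM (two_dvd_natCard_residueField_of_v_two_lt_one)

/-- **(OFF_C.v2) «OFF THE LIVE ROW EVERY RamM CONE CELL CONTRIBUTES ZERO», FROM ITS PIECES — THE LANE-C DISPATCH (ED. 1-C).**  Binders: `N`, then `OFF_C.letter.v2`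
(a2c0234d7b04450d)'s binder block BYTE FOR BYTE, then `hparC : m % 2 = 0`, then THREE sockets over the bound names (`ℓ₀ := d % 2`, `μ = lam − jE u₀₀`, `m = v_M(μ)`, `jl = v_M(μ − ρμ)`,
`cellDiff(j,b)` := the letter's two-finsum difference VERBATIM; each with the live-class premise `j + 1 = b + s0 ∨ (b + s0 ≤ j ∧ (j − b − s0) % 2 = 0)`): `hEvenRowC` (odd `d`: `m = 4b`),
`hTopC` (top line `jl + 2b = 2j + dρ + m`, `m < 4b`, `b ≤ j`), `hLowC` (lower line `jl = 2j + dρ + 2b + 2ℓ₀`, `4b + 2ℓ₀ < m`, `b < j`); conclusion = `OFF_C.letter.v2`'s body VERBATIM.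
Proof: exhaustive case split; (E0)_C∕SHALLOW∕ODD by the ★ RamM atlas (transported from `ϖM` to `α` by `_c6`), FAR∕HIGH′ ★ p862671∕p862962, DEEP and the odd-`d` level-0 strip ★ p863162,
emptiness ⇒ `0 − 0`; lane-C weights `|jEϖ| = exp(−2)`, `|cc(α − ρα)| = exp(−(2j + dρ))`, and the two in-file facts `jl ≡ dρ (mod 2)`, `m + dρ ≤ jl`.
[cite: Kottwitz1986BaseChangeUnits, §1 pp. 240–241] [cite: Jacobowitz1962, §4] [cite: Flicker1998UnitaryFL, Prop. 7 p. 84] [cite: Serre1979, Ch. III §6 Prop. 12] -/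
theorem cellDiff_offRowC_eq_zero_of_pieces (N : ℕ → ℕ → ℕ)
    {E M : Type} [Field E] [Valued E ℤᵐ⁰] [CompleteSpace E] [IsDiscreteValuationRing 𝒪[E]] [Finite 𝓀[E]]
    [Field M] [Valued M ℤᵐ⁰] [CompleteSpace M] [IsDiscreteValuationRing 𝒪[M]] [Finite 𝓀[M]]
        (σ : E →+* E) (ϖ : E) (d tE : ℕ) (_hD : IsRamifiedQuadraticDatum σ ϖ d tE) (_hσσ : ∀ a, σ (σ a) = a) (_h2 : ¬ IsUnit (2 : 𝒪[E]))
        (jE : E →+* M) (ρ Θ : M →+* M) (α lam : M)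
        (_hρρ : ∀ z, ρ (ρ z) = z) (_hvρ : ∀ z, Valued.v (ρ z) = Valued.v z) (_hρj : ∀ a, ρ (jE a) = jE a)
        (_hjv : ∀ a, Valued.v (jE a) ≤ 1 ↔ Valued.v a ≤ 1) (_hjfix : ∀ z : M, ρ z = z ↔ ∃ a, jE a = z) (_hΘj : ∀ a, Θ (jE a) = jE (σ a))
        (_hΘΘ : ∀ z, Θ (Θ z) = z) (_hΘρ : ∀ z, Θ (ρ z) = ρ (Θ z)) (_hvΘ : ∀ z, Valued.v (Θ z) = Valued.v z)
        (_hα : ρ α ≠ α) (_hα1 : Valued.v α ≤ 1) (_hint : ∀ z : M, Valued.v z ≤ 1 → Valued.v ((z - ρ z) / (α - ρ α)) ≤ 1)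
        (_hΘlam : Θ lam * lam = 1) (_hvlam : Valued.v lam = 1) (_hbasis : ∀ z : M, ∃! pq : E × E, z = jE pq.1 + jE pq.2 * lam)
        (_hC : Valued.v (α - ρ α) < 1) (ϖM c₀ n₀ : M) (dρ dΘ dτ g s0 dK d' : ℕ)
        (_c1 : ∀ a, Valued.v (jE a) = Valued.v a ^ 2) (_c2 : Nat.card 𝓀[M] = Nat.card 𝓀[E]) (_c3 : ∀ z : M, Valued.v z ≤ 1 → Valued.v (z - Θ z) < 1) (_c4 : ∀ z : M, Valued.v z ≤ 1 → Valued.v (z - Θ (ρ z)) < 1)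
        (_c5 : Valued.v ϖM = WithZero.exp (-1 : ℤ)) (_c6 : α - ρ α = ϖM - ρ ϖM) (_c7 : IsRamifiedQuadraticDatum ρ ϖM dρ (2 * tE)) (_c8 : IsRamifiedQuadraticDatum Θ ϖM dΘ (2 * tE)) (_c9 : 1 ≤ dτ)
        (_c10 : Valued.v (ϖM - Θ (ρ ϖM)) = Valued.v ϖM ^ dτ) (_c11 : Θ c₀ = c₀) (_c12 : Valued.v c₀ = 1) (_c13 : ∀ x : M, Θ x = x → Valued.v x = 1 → (∃ z : M, z * Θ z = x) ∨ ∃ z : M, z * Θ z = c₀ * x)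
        (_c14 : ∀ f₀ : M, ρ f₀ = f₀ → Θ f₀ = f₀ → Valued.v f₀ = 1 → ∃ z : M, z * Θ z = f₀) (_c15 : Θ n₀ = n₀) (_c16 : Valued.v n₀ = 1) (_c17 : ¬ ∃ z : M, z * Θ z = n₀)
        (_c18 : ∀ x : M, ρ x = x → Θ (ρ x) = x → x ≠ 0 → ∃ n : ℤ, Valued.v x = WithZero.exp (4 * n)) (_c19 : ∀ z : M, ρ z = z → Θ z = z → z ≠ 0 → ∃ n : ℤ, Valued.v z = WithZero.exp (4 * n))
        (_c20 : ∃ a : M, Θ a = a ∧ Valued.v a = 1 ∧ ¬ ∃ e : M, ρ e = e ∧ e * Θ e = a * ρ a) (_c21 : dΘ = 2 * g) (_c22 : dτ = 2 * s0) (_c23 : 1 ≤ g) (_c24 : 1 ≤ s0) (_c25 : g + s0 = d)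
        (_c26 : Valued.v (ϖM * Θ (ρ ϖM) - ρ (ϖM * Θ (ρ ϖM))) = WithZero.exp (-(2 * (dK : ℤ)))) (_c27 : 2 * dK = dρ + 2 * g)
        (_c28 : Valued.v (ϖM * Θ ϖM - ρ (ϖM * Θ ϖM)) = WithZero.exp (-(2 * (d' : ℤ)))) (_c29 : 2 * d' = dρ + dτ) (_hjpow : ∀ (t : E) (n : ℤ), Valued.v (jE t) = Valued.v (jE ϖ) ^ n ↔ Valued.v t = Valued.v ϖ ^ n)
        (_hEval : ∀ c : M, ρ c = c → c ≠ 0 → Valued.v c ≤ 1 → ∃ n : ℕ, Valued.v c = Valued.v (jE ϖ) ^ n)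
        (_hϖmax : ∀ t : M, ρ t = t → Valued.v t < 1 → Valued.v t ≤ Valued.v (jE ϖ))
        (γ₂ : GL (Fin 2) E) (u : GL (Fin 1) E)
        (_hdet : (γ₂ : Matrix (Fin 2) (Fin 2) E).det * σ (γ₂ : Matrix (Fin 2) (Fin 2) E).det = 1)
        (_htr : (γ₂ : Matrix (Fin 2) (Fin 2) E).trace = (γ₂ : Matrix (Fin 2) (Fin 2) E).det * σ (γ₂ : Matrix (Fin 2) (Fin 2) E).trace)
        (_hirr : ∀ x : E, x * x - (γ₂ : Matrix (Fin 2) (Fin 2) E).trace * x + (γ₂ : Matrix (Fin 2) (Fin 2) E).det ≠ 0)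
        (_hlam2 : lam * lam = jE (γ₂ : Matrix (Fin 2) (Fin 2) E).trace * lam - jE (γ₂ : Matrix (Fin 2) (Fin 2) E).det)
        (_hρlam : ρ lam = jE (γ₂ : Matrix (Fin 2) (Fin 2) E).trace - lam) (m jl : ℕ) (_hm : Valued.v (lam - jE ((u : Matrix (Fin 1) (Fin 1) E) 0 0)) = WithZero.exp (-(m : ℤ)))
        (_hjl : Valued.v ((lam - jE ((u : Matrix (Fin 1) (Fin 1) E) 0 0)) - ρ (lam - jE ((u : Matrix (Fin 1) (Fin 1) E) 0 0))) = WithZero.exp (-(jl : ℤ)))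
        (_hs : Valued.v ((γ₂ : Matrix (Fin 2) (Fin 2) E).trace - 2) * Valued.v (ϖ ^ (d % 2)) ≤ Valued.v (ϖ ^ mcOfRecord d))
        (_hp : Valued.v ((γ₂ : Matrix (Fin 2) (Fin 2) E).det - (γ₂ : Matrix (Fin 2) (Fin 2) E).trace + 1) ≤ Valued.v (ϖ ^ mcOfRecord d))
        (_hNm : N d tE ≤ m) (_hu1N : Valued.v (((u : Matrix (Fin 1) (Fin 1) E) 0 0) - 1) ≤ Valued.v (ϖ ^ N d tE)) (_hlam1 : Valued.v (lam - 1) ≤ Valued.v (jE ϖ ^ N d tE))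
        (_hu : Valued.v ((u : Matrix (Fin 1) (Fin 1) E) 0 0) = 1) (_hum : Valued.v (((u : Matrix (Fin 1) (Fin 1) E) 0 0) - 1) ≤ Valued.v (ϖ ^ mstarOfRecord d))
        (H₂ : Matrix (Fin 2) (Fin 2) E) (hW : E) (_hH₂ : IsUnit H₂.det) (_hH₂σ : (H₂.map σ)ᵀ = H₂) (_hhW : Valued.v hW = 1) (_hhWσ : σ hW = hW)
        (P₁ : GL (Fin 3) E) (_hA : formCongr σ P₁ ((StdForm.antidiagonal 3).over E) = (!![H₂ 0 0, 0, H₂ 0 1; 0, hW, 0; H₂ 1 0, 0, H₂ 1 1] : Matrix (Fin 3) (Fin 3) E))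
        (_hΓ : P₁ * endoGL (γ₂, u) * P₁⁻¹ ∈ unitaryGroupOfForm σ ((StdForm.antidiagonal 3).over E))
        (φ : (Fin 2 → E) →+ M) (h : M) (_hφs : ∀ (c : E) (x : Fin 2 → E), φ (c • x) = jE c * φ x) (_hφi : Function.Injective φ) (_hφo : Function.Surjective φ)
        (_hφγ : ∀ x, φ ((γ₂ : Matrix (Fin 2) (Fin 2) E).mulVec x) = lam * φ x)
        (_hform : ∀ x y, jE (pairing σ H₂ x y) = h * Θ (φ x) * φ y + ρ (h * Θ (φ x) * φ y)) (_hΘh : Θ h = h) (_hh : h ≠ 0)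
        (J R : ℕ) (f : ℕ → ℕ → AddSubgroup M → ℕ)
        (_hfinF : {L₃ : Submodule 𝒪[E] (Fin 3 → E) | IsSelfDualLattice σ ϖ (!![H₂ 0 0, 0, H₂ 0 1; 0, hW, 0; H₂ 1 0, 0, H₂ 1 1] : Matrix (Fin 3) (Fin 3) E) L₃ ∧ mapGL (endoGL (γ₂, u)) L₃ = L₃}.Finite)
        (_hR : ∀ L₃ : Submodule 𝒪[E] (Fin 3 → E), IsSelfDualLattice σ ϖ (!![H₂ 0 0, 0, H₂ 0 1; 0, hW, 0; H₂ 1 0, 0, H₂ 1 1] : Matrix (Fin 3) (Fin 3) E) L₃ →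
          mapGL (endoGL (γ₂, u)) L₃ = L₃ → ∀ b : ℕ, (∀ c : E, (Pi.single 1 c : Fin 3 → E) ∈ L₃ ↔ Valued.v c ≤ Valued.v ϖ ^ b) → b ≤ R)
        (_hJ : ¬ IsOrd ρ α (jE ϖ ^ (J + 1)) lam) (_hfinLS : ∀ j a, (levelSet ρ Θ α (jE ϖ) h j a).Finite)
        (_hf : ∀ (b j : ℕ) (Λ : AddSubgroup M) (x₀ : M) (r : E), 1 ≤ b → x₀ ≠ 0 → (∀ x, x ∈ Λ ↔ ∃ z, IsOrd ρ α (jE ϖ ^ j) z ∧ x = x₀ * z) →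
          IsOrd ρ α (jE ϖ ^ j) (dualGen ρ Θ α (jE ϖ ^ j) h x₀) → ¬ IsOrd ρ α (jE ϖ ^ j) (dualGen ρ Θ α (jE ϖ ^ j) h x₀ / jE ϖ) → Valued.v (dualGen ρ Θ α (jE ϖ ^ j) h x₀) = Valued.v (jE ϖ) ^ b →
          (∀ b', (∀ x ∈ Λ, Valued.v (h * Θ x * b' + ρ (h * Θ x * b')) ≤ 1) → (lam - jE ((u : Matrix (Fin 1) (Fin 1) E) 0 0)) * b' ∈ Λ) → IsOrd ρ α (jE ϖ ^ j) lam →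
          jE r = glueUnit ρ Θ α (jE ϖ ^ j) h (jE ϖ) (jE hW) x₀ b →
          f b j Λ = Nat.card {x : 𝒪[E] ⧸ 𝓂[E] ^ (2 * b) // ∃ u' : 𝒪[E], Ideal.Quotient.mk (𝓂[E] ^ (2 * b)) u' = x ∧ Valued.v ((u' : E) * σ u' - r) ≤ Valued.v (ϖ ^ (2 * b))})
    (hparC : m % 2 = 0)
    (hEvenRowC : ∀ j b : ℕ, 1 ≤ b → b ≤ j → d % 2 = 1 → m = 4 * b → (j + 1 = b + s0 ∨ (b + s0 ≤ j ∧ (j - b - s0) % 2 = 0)) → IsOrd ρ α (jE ϖ ^ j) lam →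
                ((∑ᶠ Λ ∈ levelSetDep ρ Θ α (jE ϖ) h j b (lam - jE ((u : Matrix (Fin 1) (Fin 1) E) 0 0)) ∩
                      {Λ | ∃ B : Submodule 𝒪[E] (Fin 2 → E), B.toAddSubgroup.map φ = Λ ∧
                        ∃ L₃ : Submodule 𝒪[E] (Fin 3 → E), IsSelfDualLattice σ ϖ (!![H₂ 0 0, 0, H₂ 0 1; 0, hW, 0; H₂ 1 0, 0, H₂ 1 1] : Matrix (Fin 3) (Fin 3) E) L₃ ∧
                          L₃ ⊓ LinearMap.ker ((LinearMap.proj (1 : Fin 3) : (Fin 3 → E) →ₗ[E] E).restrictScalars 𝒪[E]) =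
                            B.map ((Matrix.toLin' (!![1, 0; 0, 0; 0, 1] : Matrix (Fin 3) (Fin 2) E)).restrictScalars 𝒪[E]) ∧
                          (∀ c : E, (Pi.single 1 c : Fin 3 → E) ∈ L₃ ↔ Valued.v c ≤ Valued.v ϖ ^ b) ∧
                          (LatticeNearTransvShell ϖ (d % 2) (mstarOfRecord d) ((((endoGL (γ₂, u) : GL (Fin 3) E) : Matrix (Fin 3) (Fin 3) E) - 1)) L₃ ∧
                            {z : E | ∃ y ∈ L₃, Valued.v ((ϖ ^ (mstarOfRecord d))⁻¹ * (z - pairing σ (!![H₂ 0 0, 0, H₂ 0 1; 0, hW, 0; H₂ 1 0, 0, H₂ 1 1] : Matrix (Fin 3) (Fin 3) E) y (((((endoGL (γ₂, u) : GL (Fin 3) E) : Matrix (Fin 3) (Fin 3) E) - 1)) *ᵥ y))) ≤ 1} =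
                              valueSetMod σ ϖ (mstarOfRecord d) (xPlus σ ϖ d))}, f b j Λ : ℕ) : ℤ) -
                  ((∑ᶠ Λ ∈ levelSetDep ρ Θ α (jE ϖ) h j b (lam - jE ((u : Matrix (Fin 1) (Fin 1) E) 0 0)) ∩
                      {Λ | ∃ B : Submodule 𝒪[E] (Fin 2 → E), B.toAddSubgroup.map φ = Λ ∧
                        ∃ L₃ : Submodule 𝒪[E] (Fin 3 → E), IsSelfDualLattice σ ϖ (!![H₂ 0 0, 0, H₂ 0 1; 0, hW, 0; H₂ 1 0, 0, H₂ 1 1] : Matrix (Fin 3) (Fin 3) E) L₃ ∧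
                          L₃ ⊓ LinearMap.ker ((LinearMap.proj (1 : Fin 3) : (Fin 3 → E) →ₗ[E] E).restrictScalars 𝒪[E]) =
                            B.map ((Matrix.toLin' (!![1, 0; 0, 0; 0, 1] : Matrix (Fin 3) (Fin 2) E)).restrictScalars 𝒪[E]) ∧
                          (∀ c : E, (Pi.single 1 c : Fin 3 → E) ∈ L₃ ↔ Valued.v c ≤ Valued.v ϖ ^ b) ∧
                          (LatticeNearTransvShell ϖ (d % 2) (mcOfRecord d) ((((endoGL (γ₂, u) : GL (Fin 3) E) : Matrix (Fin 3) (Fin 3) E) - 1)) L₃ ∧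
                            ¬ {z : E | ∃ y ∈ L₃, Valued.v ((ϖ ^ (mstarOfRecord d))⁻¹ * (z - pairing σ (!![H₂ 0 0, 0, H₂ 0 1; 0, hW, 0; H₂ 1 0, 0, H₂ 1 1] : Matrix (Fin 3) (Fin 3) E) y (((((endoGL (γ₂, u) : GL (Fin 3) E) : Matrix (Fin 3) (Fin 3) E) - 1)) *ᵥ y))) ≤ 1} =
                              valueSetMod σ ϖ (mstarOfRecord d) (xPlus σ ϖ d))}, f b j Λ : ℕ) : ℤ) = 0)
    (hTopC : ∀ j b : ℕ, 1 ≤ b → b ≤ j → m < 4 * b → jl + 2 * b = 2 * j + dρ + m → (j + 1 = b + s0 ∨ (b + s0 ≤ j ∧ (j - b - s0) % 2 = 0)) → IsOrd ρ α (jE ϖ ^ j) lam →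
                ((∑ᶠ Λ ∈ levelSetDep ρ Θ α (jE ϖ) h j b (lam - jE ((u : Matrix (Fin 1) (Fin 1) E) 0 0)) ∩
                      {Λ | ∃ B : Submodule 𝒪[E] (Fin 2 → E), B.toAddSubgroup.map φ = Λ ∧
                        ∃ L₃ : Submodule 𝒪[E] (Fin 3 → E), IsSelfDualLattice σ ϖ (!![H₂ 0 0, 0, H₂ 0 1; 0, hW, 0; H₂ 1 0, 0, H₂ 1 1] : Matrix (Fin 3) (Fin 3) E) L₃ ∧
                          L₃ ⊓ LinearMap.ker ((LinearMap.proj (1 : Fin 3) : (Fin 3 → E) →ₗ[E] E).restrictScalars 𝒪[E]) =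
                            B.map ((Matrix.toLin' (!![1, 0; 0, 0; 0, 1] : Matrix (Fin 3) (Fin 2) E)).restrictScalars 𝒪[E]) ∧
                          (∀ c : E, (Pi.single 1 c : Fin 3 → E) ∈ L₃ ↔ Valued.v c ≤ Valued.v ϖ ^ b) ∧
                          (LatticeNearTransvShell ϖ (d % 2) (mstarOfRecord d) ((((endoGL (γ₂, u) : GL (Fin 3) E) : Matrix (Fin 3) (Fin 3) E) - 1)) L₃ ∧
                            {z : E | ∃ y ∈ L₃, Valued.v ((ϖ ^ (mstarOfRecord d))⁻¹ * (z - pairing σ (!![H₂ 0 0, 0, H₂ 0 1; 0, hW, 0; H₂ 1 0, 0, H₂ 1 1] : Matrix (Fin 3) (Fin 3) E) y (((((endoGL (γ₂, u) : GL (Fin 3) E) : Matrix (Fin 3) (Fin 3) E) - 1)) *ᵥ y))) ≤ 1} =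
                              valueSetMod σ ϖ (mstarOfRecord d) (xPlus σ ϖ d))}, f b j Λ : ℕ) : ℤ) -
                  ((∑ᶠ Λ ∈ levelSetDep ρ Θ α (jE ϖ) h j b (lam - jE ((u : Matrix (Fin 1) (Fin 1) E) 0 0)) ∩
                      {Λ | ∃ B : Submodule 𝒪[E] (Fin 2 → E), B.toAddSubgroup.map φ = Λ ∧
                        ∃ L₃ : Submodule 𝒪[E] (Fin 3 → E), IsSelfDualLattice σ ϖ (!![H₂ 0 0, 0, H₂ 0 1; 0, hW, 0; H₂ 1 0, 0, H₂ 1 1] : Matrix (Fin 3) (Fin 3) E) L₃ ∧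
                          L₃ ⊓ LinearMap.ker ((LinearMap.proj (1 : Fin 3) : (Fin 3 → E) →ₗ[E] E).restrictScalars 𝒪[E]) =
                            B.map ((Matrix.toLin' (!![1, 0; 0, 0; 0, 1] : Matrix (Fin 3) (Fin 2) E)).restrictScalars 𝒪[E]) ∧
                          (∀ c : E, (Pi.single 1 c : Fin 3 → E) ∈ L₃ ↔ Valued.v c ≤ Valued.v ϖ ^ b) ∧
                          (LatticeNearTransvShell ϖ (d % 2) (mcOfRecord d) ((((endoGL (γ₂, u) : GL (Fin 3) E) : Matrix (Fin 3) (Fin 3) E) - 1)) L₃ ∧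
                            ¬ {z : E | ∃ y ∈ L₃, Valued.v ((ϖ ^ (mstarOfRecord d))⁻¹ * (z - pairing σ (!![H₂ 0 0, 0, H₂ 0 1; 0, hW, 0; H₂ 1 0, 0, H₂ 1 1] : Matrix (Fin 3) (Fin 3) E) y (((((endoGL (γ₂, u) : GL (Fin 3) E) : Matrix (Fin 3) (Fin 3) E) - 1)) *ᵥ y))) ≤ 1} =
                              valueSetMod σ ϖ (mstarOfRecord d) (xPlus σ ϖ d))}, f b j Λ : ℕ) : ℤ) = 0)
    (hLowC : ∀ j b : ℕ, 1 ≤ b → b < j → 4 * b + 2 * (d % 2) < m → jl = 2 * j + dρ + 2 * b + 2 * (d % 2) → (j + 1 = b + s0 ∨ (b + s0 ≤ j ∧ (j - b - s0) % 2 = 0)) → IsOrd ρ α (jE ϖ ^ j) lam →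
                ((∑ᶠ Λ ∈ levelSetDep ρ Θ α (jE ϖ) h j b (lam - jE ((u : Matrix (Fin 1) (Fin 1) E) 0 0)) ∩
                      {Λ | ∃ B : Submodule 𝒪[E] (Fin 2 → E), B.toAddSubgroup.map φ = Λ ∧
                        ∃ L₃ : Submodule 𝒪[E] (Fin 3 → E), IsSelfDualLattice σ ϖ (!![H₂ 0 0, 0, H₂ 0 1; 0, hW, 0; H₂ 1 0, 0, H₂ 1 1] : Matrix (Fin 3) (Fin 3) E) L₃ ∧
                          L₃ ⊓ LinearMap.ker ((LinearMap.proj (1 : Fin 3) : (Fin 3 → E) →ₗ[E] E).restrictScalars 𝒪[E]) =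
                            B.map ((Matrix.toLin' (!![1, 0; 0, 0; 0, 1] : Matrix (Fin 3) (Fin 2) E)).restrictScalars 𝒪[E]) ∧
                          (∀ c : E, (Pi.single 1 c : Fin 3 → E) ∈ L₃ ↔ Valued.v c ≤ Valued.v ϖ ^ b) ∧
                          (LatticeNearTransvShell ϖ (d % 2) (mstarOfRecord d) ((((endoGL (γ₂, u) : GL (Fin 3) E) : Matrix (Fin 3) (Fin 3) E) - 1)) L₃ ∧
                            {z : E | ∃ y ∈ L₃, Valued.v ((ϖ ^ (mstarOfRecord d))⁻¹ * (z - pairing σ (!![H₂ 0 0, 0, H₂ 0 1; 0, hW, 0; H₂ 1 0, 0, H₂ 1 1] : Matrix (Fin 3) (Fin 3) E) y (((((endoGL (γ₂, u) : GL (Fin 3) E) : Matrix (Fin 3) (Fin 3) E) - 1)) *ᵥ y))) ≤ 1} =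
                              valueSetMod σ ϖ (mstarOfRecord d) (xPlus σ ϖ d))}, f b j Λ : ℕ) : ℤ) -
                  ((∑ᶠ Λ ∈ levelSetDep ρ Θ α (jE ϖ) h j b (lam - jE ((u : Matrix (Fin 1) (Fin 1) E) 0 0)) ∩
                      {Λ | ∃ B : Submodule 𝒪[E] (Fin 2 → E), B.toAddSubgroup.map φ = Λ ∧
                        ∃ L₃ : Submodule 𝒪[E] (Fin 3 → E), IsSelfDualLattice σ ϖ (!![H₂ 0 0, 0, H₂ 0 1; 0, hW, 0; H₂ 1 0, 0, H₂ 1 1] : Matrix (Fin 3) (Fin 3) E) L₃ ∧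
                          L₃ ⊓ LinearMap.ker ((LinearMap.proj (1 : Fin 3) : (Fin 3 → E) →ₗ[E] E).restrictScalars 𝒪[E]) =
                            B.map ((Matrix.toLin' (!![1, 0; 0, 0; 0, 1] : Matrix (Fin 3) (Fin 2) E)).restrictScalars 𝒪[E]) ∧
                          (∀ c : E, (Pi.single 1 c : Fin 3 → E) ∈ L₃ ↔ Valued.v c ≤ Valued.v ϖ ^ b) ∧
                          (LatticeNearTransvShell ϖ (d % 2) (mcOfRecord d) ((((endoGL (γ₂, u) : GL (Fin 3) E) : Matrix (Fin 3) (Fin 3) E) - 1)) L₃ ∧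
                            ¬ {z : E | ∃ y ∈ L₃, Valued.v ((ϖ ^ (mstarOfRecord d))⁻¹ * (z - pairing σ (!![H₂ 0 0, 0, H₂ 0 1; 0, hW, 0; H₂ 1 0, 0, H₂ 1 1] : Matrix (Fin 3) (Fin 3) E) y (((((endoGL (γ₂, u) : GL (Fin 3) E) : Matrix (Fin 3) (Fin 3) E) - 1)) *ᵥ y))) ≤ 1} =
                              valueSetMod σ ϖ (mstarOfRecord d) (xPlus σ ϖ d))}, f b j Λ : ℕ) : ℤ) = 0) :
        ∀ b ∈ Finset.Icc 1 R, 4 * b + 2 * (d % 2) ≠ m → ∀ j ∈ Finset.range (J + 1), IsOrd ρ α (jE ϖ ^ j) lam →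
                ((∑ᶠ Λ ∈ levelSetDep ρ Θ α (jE ϖ) h j b (lam - jE ((u : Matrix (Fin 1) (Fin 1) E) 0 0)) ∩
                      {Λ | ∃ B : Submodule 𝒪[E] (Fin 2 → E), B.toAddSubgroup.map φ = Λ ∧
                        ∃ L₃ : Submodule 𝒪[E] (Fin 3 → E), IsSelfDualLattice σ ϖ (!![H₂ 0 0, 0, H₂ 0 1; 0, hW, 0; H₂ 1 0, 0, H₂ 1 1] : Matrix (Fin 3) (Fin 3) E) L₃ ∧
                          L₃ ⊓ LinearMap.ker ((LinearMap.proj (1 : Fin 3) : (Fin 3 → E) →ₗ[E] E).restrictScalars 𝒪[E]) =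
                            B.map ((Matrix.toLin' (!![1, 0; 0, 0; 0, 1] : Matrix (Fin 3) (Fin 2) E)).restrictScalars 𝒪[E]) ∧
                          (∀ c : E, (Pi.single 1 c : Fin 3 → E) ∈ L₃ ↔ Valued.v c ≤ Valued.v ϖ ^ b) ∧
                          (LatticeNearTransvShell ϖ (d % 2) (mstarOfRecord d) ((((endoGL (γ₂, u) : GL (Fin 3) E) : Matrix (Fin 3) (Fin 3) E) - 1)) L₃ ∧
                            {z : E | ∃ y ∈ L₃, Valued.v ((ϖ ^ (mstarOfRecord d))⁻¹ * (z - pairing σ (!![H₂ 0 0, 0, H₂ 0 1; 0, hW, 0; H₂ 1 0, 0, H₂ 1 1] : Matrix (Fin 3) (Fin 3) E) y (((((endoGL (γ₂, u) : GL (Fin 3) E) : Matrix (Fin 3) (Fin 3) E) - 1)) *ᵥ y))) ≤ 1} =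
                              valueSetMod σ ϖ (mstarOfRecord d) (xPlus σ ϖ d))}, f b j Λ : ℕ) : ℤ) -
                  ((∑ᶠ Λ ∈ levelSetDep ρ Θ α (jE ϖ) h j b (lam - jE ((u : Matrix (Fin 1) (Fin 1) E) 0 0)) ∩
                      {Λ | ∃ B : Submodule 𝒪[E] (Fin 2 → E), B.toAddSubgroup.map φ = Λ ∧
                        ∃ L₃ : Submodule 𝒪[E] (Fin 3 → E), IsSelfDualLattice σ ϖ (!![H₂ 0 0, 0, H₂ 0 1; 0, hW, 0; H₂ 1 0, 0, H₂ 1 1] : Matrix (Fin 3) (Fin 3) E) L₃ ∧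
                          L₃ ⊓ LinearMap.ker ((LinearMap.proj (1 : Fin 3) : (Fin 3 → E) →ₗ[E] E).restrictScalars 𝒪[E]) =
                            B.map ((Matrix.toLin' (!![1, 0; 0, 0; 0, 1] : Matrix (Fin 3) (Fin 2) E)).restrictScalars 𝒪[E]) ∧
                          (∀ c : E, (Pi.single 1 c : Fin 3 → E) ∈ L₃ ↔ Valued.v c ≤ Valued.v ϖ ^ b) ∧
                          (LatticeNearTransvShell ϖ (d % 2) (mcOfRecord d) ((((endoGL (γ₂, u) : GL (Fin 3) E) : Matrix (Fin 3) (Fin 3) E) - 1)) L₃ ∧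
                            ¬ {z : E | ∃ y ∈ L₃, Valued.v ((ϖ ^ (mstarOfRecord d))⁻¹ * (z - pairing σ (!![H₂ 0 0, 0, H₂ 0 1; 0, hW, 0; H₂ 1 0, 0, H₂ 1 1] : Matrix (Fin 3) (Fin 3) E) y (((((endoGL (γ₂, u) : GL (Fin 3) E) : Matrix (Fin 3) (Fin 3) E) - 1)) *ᵥ y))) ≤ 1} =
                              valueSetMod σ ϖ (mstarOfRecord d) (xPlus σ ϖ d))}, f b j Λ : ℕ) : ℤ) = 0 := by
  -- sizes read off the letters: the lane-C weights
  obtain ⟨hσ, hvσ, hϖ, -, -, h1d, -⟩ := id _hD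
  obtain ⟨-, -, -, hevρ, hddρ, -, -⟩ := id _c7
  have hρϖ : ρ (jE ϖ) = jE ϖ := _hρj ϖ
  have hq : Valued.v (jE ϖ) = exp (-2 : ℤ) := by
    rw [_c1, hϖ, ← exp_nsmul, nsmul_eq_mul]; norm_num
  have hqpow : ∀ n : ℕ, Valued.v (jE ϖ) ^ n = exp (-(2 * (n : ℤ))) := fun n => by
    rw [hq, ← exp_nsmul, nsmul_eq_mul]; congr 1; ring
  have hδ : Valued.v (α - ρ α) = exp (-(dρ : ℤ)) := by
    rw [_c6, hddρ, _c5, ← exp_nsmul, nsmul_eq_mul, mul_neg, mul_one]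
  have hδ0 : α - ρ α ≠ 0 := fun h0 => by rw [h0, map_zero] at hδ; exact (exp_ne_zero hδ.symm).elim
  have hcc : ∀ n : ℕ, Valued.v (jE ϖ ^ n * (α - ρ α)) = exp (-(2 * (n : ℤ) + dρ)) := fun n => by
    rw [map_mul, hδ, map_pow, hqpow, ← exp_add]; congr 1; ring
  -- `jl ≡ dρ (mod 2)`: `(μ − ρμ)∕(α − ρα)` is `ρ`-fixed and non-zero, so of even order (`_c7`)
  have hμρ0 : (lam - jE ((u : Matrix (Fin 1) (Fin 1) E) 0 0)) - ρ (lam - jE ((u : Matrix (Fin 1) (Fin 1) E) 0 0)) ≠ 0 := fun h0 => by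
    rw [h0, map_zero] at _hjl; exact (exp_ne_zero _hjl.symm).elim
  have hjlpar : ∃ n : ℤ, (jl : ℤ) = dρ + 2 * n := by
    have hρn : ρ ((lam - jE ((u : Matrix (Fin 1) (Fin 1) E) 0 0)) - ρ (lam - jE ((u : Matrix (Fin 1) (Fin 1) E) 0 0))) = -((lam - jE ((u : Matrix (Fin 1) (Fin 1) E) 0 0)) - ρ (lam - jE ((u : Matrix (Fin 1) (Fin 1) E) 0 0))) := by
      rw [map_sub (ρ) ((lam - jE ((u : Matrix (Fin 1) (Fin 1) E) 0 0))), _hρρ]; ring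
    have hρd : ρ (α - ρ α) = -(α - ρ α) := by rw [map_sub, _hρρ]; ring
    have hρf : ρ (((lam - jE ((u : Matrix (Fin 1) (Fin 1) E) 0 0)) - ρ (lam - jE ((u : Matrix (Fin 1) (Fin 1) E) 0 0))) / (α - ρ α)) = ((lam - jE ((u : Matrix (Fin 1) (Fin 1) E) 0 0)) - ρ (lam - jE ((u : Matrix (Fin 1) (Fin 1) E) 0 0))) / (α - ρ α) := by
      rw [map_div₀, hρn, hρd, neg_div_neg_eq]
    obtain ⟨n, hn⟩ := hevρ _ hρf (div_ne_zero hμρ0 hδ0)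
    rw [map_div₀, _hjl, hδ, ← exp_sub] at hn
    exact ⟨-n, by have := exp_injective hn; omega⟩
  -- `m + dρ ≤ jl`: `_hint` at `z = μ ∕ jEϖ^{m∕2}` (`|z| = 1` since `m` is even)
  have hmjl : m + dρ ≤ jl := by
    have hz1 : Valued.v ((lam - jE ((u : Matrix (Fin 1) (Fin 1) E) 0 0)) / jE ϖ ^ (m / 2)) ≤ 1 := by
      rw [map_div₀, _hm, map_pow, hqpow, ← exp_sub, ← exp_zero, exp_le_exp]; push_cast; omega
    have key := _hint _ hz1
    have e : (lam - jE ((u : Matrix (Fin 1) (Fin 1) E) 0 0)) / jE ϖ ^ (m / 2) - ρ ((lam - jE ((u : Matrix (Fin 1) (Fin 1) E) 0 0)) / jE ϖ ^ (m / 2)) = ((lam - jE ((u : Matrix (Fin 1) (Fin 1) E) 0 0)) - ρ (lam - jE ((u : Matrix (Fin 1) (Fin 1) E) 0 0))) / jE ϖ ^ (m / 2) := by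
      rw [map_div₀, map_pow, hρϖ, div_sub_div_same]
    rw [e, map_div₀, map_div₀, _hjl, map_pow, hqpow, hδ, ← exp_sub, ← exp_sub, ← exp_zero, exp_le_exp] at key
    push_cast at key; omega
  -- the `α ↦ ϖM` transport of the u-free level sets (`_c6`), and the plumbing of the ★ RamM atlas
  have hLS : ∀ j b : ℕ, levelSet ρ Θ α (jE ϖ) h j b = levelSet ρ Θ ϖM (jE ϖ) h j b := fun j b =>
    levelSet_eq_of_mul_sub_map_eq (Θ := Θ) (by rw [_c6]) (by rw [_c6]) (jE ϖ) j b
  have h2E : Valued.v (2 : E) < 1 := by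
    have h2 := Valuation.Integer.not_isUnit_iff_valuation_lt_one.mp _h2
    exact_mod_cast h2
  have h2M : Valued.v (2 : M) < 1 := by
    have h2 := _c1 2
    rw [map_ofNat] at h2
    rw [h2]; exact pow_lt_one₀ zero_le h2E two_ne_zero
  have hq2 : 2 ∣ Nat.card 𝓀[M] := two_dvd_natCard_residueField_of_v_two_lt_one h2M rfl
  obtain ⟨eh, heh⟩ := HermitianLattice.exists_v_eq_exp _hh
  have hvh : Valued.v h = exp (-(-eh)) := by rw [neg_neg]; exact heh
  have hds : 2 * d' = dρ + 2 * s0 := by omega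
  obtain ⟨e, he⟩ := exists_half_order_add _c8.2.2.2.1 _hΘh _hh hvh hds
  have hE0 : ∀ j b : ℕ, j < b → levelSet ρ Θ α (jE ϖ) h j b = ∅ := fun j b hlt => by
    rw [hLS]
    exact levelSet_eq_empty_of_lt_ramM _hρρ _hvρ _hΘΘ _hΘρ _hvΘ _c3 _c5 _c7 _c8 _c19 _c14 _c12 _c13 _c15 _c16 _c17 hq hρϖ rfl hq2 _c21 _c24 _c28 hds
          _hΘh _hh hvh he hlt
  have hSh : ∀ j b : ℕ, 1 ≤ b → b ≤ j → j - b + 1 < s0 → levelSet ρ Θ α (jE ϖ) h j b = ∅ := fun j b hb1 hbj hsh => by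
    rw [hLS]
    exact levelSet_eq_empty_of_shallow_ramM _hρρ _hvρ _hΘΘ _hΘρ _hvΘ _c3 _c5 _c7 _c8 _c19 _c14 _c12 _c13 _c15 _c16 _c17 hq hρϖ rfl hq2 _c21 _c24 _c28 hds
          _hΘh _hh hvh he hb1 hbj hsh
  have hOdd : ∀ j b : ℕ, 1 ≤ b → b + s0 ≤ j → (j - b - s0) % 2 = 1 → levelSet ρ Θ α (jE ϖ) h j b = ∅ := fun j b hb1 hk hodd => by
    rw [hLS]
    exact levelSet_eq_empty_of_odd_ramM _hρρ _hvρ _hΘΘ _hΘρ _hvΘ _c3 _c5 _c7 _c8 _c19 _c14 _c12 _c13 _c15 _c16 _c17 hq hρϖ rfl hq2 _c21 _c24 _c28 hds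
          _hΘh _hh hvh he hb1 hk hodd
  have hempty : ∀ j b : ℕ, levelSetDep ρ Θ α (jE ϖ) h j b (lam - jE ((u : Matrix (Fin 1) (Fin 1) E) 0 0)) = ∅ →
      ((∑ᶠ Λ ∈ levelSetDep ρ Θ α (jE ϖ) h j b (lam - jE ((u : Matrix (Fin 1) (Fin 1) E) 0 0)) ∩
      {Λ | ∃ B : Submodule 𝒪[E] (Fin 2 → E), B.toAddSubgroup.map φ = Λ ∧
      ∃ L₃ : Submodule 𝒪[E] (Fin 3 → E), IsSelfDualLattice σ ϖ (!![H₂ 0 0, 0, H₂ 0 1; 0, hW, 0; H₂ 1 0, 0, H₂ 1 1] : Matrix (Fin 3) (Fin 3) E) L₃ ∧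
      L₃ ⊓ LinearMap.ker ((LinearMap.proj (1 : Fin 3) : (Fin 3 → E) →ₗ[E] E).restrictScalars 𝒪[E]) =
      B.map ((Matrix.toLin' (!![1, 0; 0, 0; 0, 1] : Matrix (Fin 3) (Fin 2) E)).restrictScalars 𝒪[E]) ∧
      (∀ c : E, (Pi.single 1 c : Fin 3 → E) ∈ L₃ ↔ Valued.v c ≤ Valued.v ϖ ^ b) ∧
      (LatticeNearTransvShell ϖ (d % 2) (mstarOfRecord d) ((((endoGL (γ₂, u) : GL (Fin 3) E) : Matrix (Fin 3) (Fin 3) E) - 1)) L₃ ∧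
      {z : E | ∃ y ∈ L₃, Valued.v ((ϖ ^ (mstarOfRecord d))⁻¹ * (z - pairing σ (!![H₂ 0 0, 0, H₂ 0 1; 0, hW, 0; H₂ 1 0, 0, H₂ 1 1] : Matrix (Fin 3) (Fin 3) E) y (((((endoGL (γ₂, u) : GL (Fin 3) E) : Matrix (Fin 3) (Fin 3) E) - 1)) *ᵥ y))) ≤ 1} =
      valueSetMod σ ϖ (mstarOfRecord d) (xPlus σ ϖ d))}, f b j Λ : ℕ) : ℤ) -
      ((∑ᶠ Λ ∈ levelSetDep ρ Θ α (jE ϖ) h j b (lam - jE ((u : Matrix (Fin 1) (Fin 1) E) 0 0)) ∩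
      {Λ | ∃ B : Submodule 𝒪[E] (Fin 2 → E), B.toAddSubgroup.map φ = Λ ∧
      ∃ L₃ : Submodule 𝒪[E] (Fin 3 → E), IsSelfDualLattice σ ϖ (!![H₂ 0 0, 0, H₂ 0 1; 0, hW, 0; H₂ 1 0, 0, H₂ 1 1] : Matrix (Fin 3) (Fin 3) E) L₃ ∧
      L₃ ⊓ LinearMap.ker ((LinearMap.proj (1 : Fin 3) : (Fin 3 → E) →ₗ[E] E).restrictScalars 𝒪[E]) =
      B.map ((Matrix.toLin' (!![1, 0; 0, 0; 0, 1] : Matrix (Fin 3) (Fin 2) E)).restrictScalars 𝒪[E]) ∧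
      (∀ c : E, (Pi.single 1 c : Fin 3 → E) ∈ L₃ ↔ Valued.v c ≤ Valued.v ϖ ^ b) ∧
      (LatticeNearTransvShell ϖ (d % 2) (mcOfRecord d) ((((endoGL (γ₂, u) : GL (Fin 3) E) : Matrix (Fin 3) (Fin 3) E) - 1)) L₃ ∧
      ¬ {z : E | ∃ y ∈ L₃, Valued.v ((ϖ ^ (mstarOfRecord d))⁻¹ * (z - pairing σ (!![H₂ 0 0, 0, H₂ 0 1; 0, hW, 0; H₂ 1 0, 0, H₂ 1 1] : Matrix (Fin 3) (Fin 3) E) y (((((endoGL (γ₂, u) : GL (Fin 3) E) : Matrix (Fin 3) (Fin 3) E) - 1)) *ᵥ y))) ≤ 1} =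
      valueSetMod σ ϖ (mstarOfRecord d) (xPlus σ ϖ d))}, f b j Λ : ℕ) : ℤ) = 0 := by
    intro j b he
    rw [he, Set.empty_inter, Set.empty_inter, finsum_mem_empty, Nat.cast_zero, sub_zero]
  have hempty' := fun (j b : ℕ) (he : levelSet ρ Θ α (jE ϖ) h j b = ∅) =>
    hempty j b (Set.eq_empty_of_subset_empty (by rw [← he]; exact levelSetDep_subset ρ Θ α (jE ϖ) h j b _))
  -- FAR and HIGH′ in lane-C ℕ letters
  have hfar : ∀ j b : ℕ, b < j → jl + 2 * b < 2 * j + dρ + m → jl < 2 * j + dρ + 2 * b →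
      levelSetDep ρ Θ α (jE ϖ) h j b (lam - jE ((u : Matrix (Fin 1) (Fin 1) E) 0 0)) = ∅ := fun j b hbj h1 h2 =>
    levelSetDep_eq_empty_of_far _hρρ _hvρ _hα _hα1 _hint _hΘΘ _hΘρ _hvΘ jE _hjv hϖ hρϖ _hh hbj
      (by rw [hcc, _hm, _hjl, hqpow, ← exp_add, ← exp_add, exp_lt_exp]; omega)
      (by rw [hcc, _hjl, hqpow, ← exp_add, exp_lt_exp]; omega)
  have hhigh : ∀ j b : ℕ, 1 ≤ b → b ≤ j → m < 4 * b → 2 * j + dρ + m < jl + 2 * b →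
      levelSetDep ρ Θ α (jE ϖ) h j b (lam - jE ((u : Matrix (Fin 1) (Fin 1) E) 0 0)) = ∅ := fun j b hb1 hbj h3 h4 =>
    levelSetDep_eq_empty_of_high' _hρρ _hvρ _hα _hα1 _hint _hΘΘ _hΘρ _hvΘ jE _hjv _hjfix hϖ _hEval _hh hb1 hbj
      (by rw [hqpow, _hm, exp_lt_exp]; push_cast; omega)
      (by rw [hcc, _hm, _hjl, hqpow, ← exp_add, ← exp_add, exp_lt_exp]; omega)
  have hm1 : d % 2 + 1 ≤ mstarOfRecord d := by unfold mstarOfRecord; omega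
  have hd2 : d % 2 = 0 ∨ d % 2 = 1 := Nat.mod_two_eq_zero_or_one d
  obtain ⟨n, hn⟩ := hjlpar
  -- THE DISPATCH
  intro b hb hrow j hj hord
  rw [Finset.mem_Icc] at hb
  rw [Finset.mem_range] at hj
  obtain ⟨hb1, hbR⟩ := hb
  rcases lt_or_ge j b with hjb | hbj
  · -- (E0)_C below the diagonal
    exact hempty' j b (hE0 j b hjb)
  by_cases hsh : j + 1 < b + s0
  · -- SHALLOW class
    exact hempty' j b (hSh j b hb1 hbj (by omega))
  by_cases hod : b + s0 ≤ j ∧ (j - b - s0) % 2 = 1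
  · -- ODD class
    exact hempty' j b (hOdd j b hb1 hod.1 hod.2)
  have hlive : j + 1 = b + s0 ∨ (b + s0 ≤ j ∧ (j - b - s0) % 2 = 0) := by omega
  rcases Nat.lt_or_gt_of_ne hrow with hbelow | habove
  · -- BELOW the live row: `4b + 2ℓ₀ + 2 ≤ m` (`m` even)
    rcases le_or_gt (2 * j + dρ + 2 * b + 2 * (d % 2) + 2) jl with hdeep | hnot
    · -- DEEP: `ℓ₀ + 1` digits below both shells (★ deep-level fold, both pieces `∅`)
      have hμ : Valued.v (lam - jE ((u : Matrix (Fin 1) (Fin 1) E) 0 0)) ≤ Valued.v (jE ϖ) ^ (2 * b + (d % 2 + 1)) := by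
        rw [_hm, hqpow, exp_le_exp]; push_cast; omega
      have hanti : Valued.v ((lam - jE ((u : Matrix (Fin 1) (Fin 1) E) 0 0)) - ρ (lam - jE ((u : Matrix (Fin 1) (Fin 1) E) 0 0))) ≤ Valued.v (jE ϖ ^ j * (α - ρ α)) * Valued.v (jE ϖ) ^ (b + (d % 2 + 1)) := by
        rw [_hjl, hcc, hqpow, ← exp_add, exp_le_exp]; push_cast; omega
      rw [levelSetDep_inter_shell_eq_empty_of_deep_level σ hσ hvσ hϖ _hH₂ _hH₂σ _hhW jE _hρρ _hvρ _hα _hα1 _hint _hΘΘ _hΘρ _hvΘ _hjv _hjfix _hjpow _hϖmax φ _hφs _hφi _hφo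
          _hφγ _hvlam _hΘh _hh _hform u (d % 2) hm1 _hum hb1 hbj hord hμ hanti (mstarOfRecord d) _,
        levelSetDep_inter_shell_eq_empty_of_deep_level σ hσ hvσ hϖ _hH₂ _hH₂σ _hhW jE _hρρ _hvρ _hα _hα1 _hint _hΘΘ _hΘρ _hvΘ _hjv _hjfix _hjpow _hϖmax φ _hφs _hφi _hφo
          _hφγ _hvlam _hΘh _hh _hform u (d % 2) hm1 _hum hb1 hbj hord hμ hanti (mcOfRecord d) _, finsum_mem_empty]
      simp
    · -- not deep in `jl`: `b < j` (at `j = b`, `m + dρ ≤ jl` would make it deep)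
      have hbj' : b < j := by
        rcases hbj.eq_or_lt with hjb' | hbj'
        · exfalso; omega
        · exact hbj'
      rcases lt_or_ge jl (2 * j + dρ + 2 * b) with hlt | hge
      · -- FAR below the lower line
        exact hempty j b (hfar j b hbj' (by omega) hlt)
      · -- the strip `2j + dρ + 2b ≤ jl ≤ 2j + dρ + 2b + 2ℓ₀ + 1`, `jl ≡ dρ (mod 2)`
        rcases hd2 with h0 | h1
        · -- even `d`: the strip is the lower line
          exact hLowC j b hb1 hbj' hbelow (by omega) hlive hord
        · rcases Nat.lt_or_ge jl (2 * j + dρ + 2 * b + 2) with hlo | hhi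
          · -- odd `d`, the LEVEL-0 STRIP `jl = 2j + dρ + 2b`: no vertex on a level-`1` shell (★ antidiagonal fold)
            have hjl0 : jl = 2 * j + dρ + 2 * b := by omega
            have hμ : Valued.v (lam - jE ((u : Matrix (Fin 1) (Fin 1) E) 0 0)) ≤ Valued.v (jE ϖ) ^ (2 * b + 1) := by
              rw [_hm, hqpow, exp_le_exp]; push_cast; omega
            have hanti : Valued.v ((lam - jE ((u : Matrix (Fin 1) (Fin 1) E) 0 0)) - ρ (lam - jE ((u : Matrix (Fin 1) (Fin 1) E) 0 0))) = Valued.v (jE ϖ ^ j * (α - ρ α)) * Valued.v (jE ϖ) ^ b := by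
              rw [_hjl, hcc, hqpow, ← exp_add]; congr 1; omega
            simp only [h1]
            rw [levelSetDep_inter_shell_eq_empty_of_antidiagonal_one σ hσ hvσ hϖ _hH₂ _hH₂σ _hhW jE _hρρ _hvρ _hα _hα1 _hint _hΘΘ _hΘρ _hvΘ _hjv _hjfix _hjpow _hϖmax
                φ _hφs _hφi _hφo _hφγ _hvlam _hΘh _hh _hform u hb1 hbj' hord hμ hanti (mstarOfRecord d) _,
              levelSetDep_inter_shell_eq_empty_of_antidiagonal_one σ hσ hvσ hϖ _hH₂ _hH₂σ _hhW jE _hρρ _hvρ _hα _hα1 _hint _hΘΘ _hΘρ _hvΘ _hjv _hjfix _hjpow _hϖmax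
                φ _hφs _hφi _hφo _hφγ _hvlam _hΘh _hh _hform u hb1 hbj' hord hμ hanti (mcOfRecord d) _, finsum_mem_empty]
            simp
          · -- odd `d`, the LOWER LINE `jl = 2j + dρ + 2b + 2` (socket)
            exact hLowC j b hb1 hbj' hbelow (by omega) hlive hord
  · -- ABOVE the live row: `m ≤ 4b + 2ℓ₀ − 2`
    by_cases h4b : m = 4 * b
    · -- the even-parity row at odd `d` (socket)
      exact hEvenRowC j b hb1 hbj (by omega) h4b hlive hord
    have hm4b : m < 4 * b := by omega
    rcases lt_trichotomy (jl + 2 * b) (2 * j + dρ + m) with h3 | h3 | h3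
    · -- beyond the top line: FAR (`b < j`; at `j = b` impossible by `m + dρ ≤ jl`)
      rcases hbj.eq_or_lt with hjb' | hbj'
      · exfalso; omega
      · exact hempty j b (hfar j b hbj' h3 (by omega))
    · -- THE TOP LINE (socket)
      exact hTopC j b hb1 hbj hm4b h3 hlive hord
    · -- inside the top line: HIGH′
      exact hempty j b (hhigh j b hb1 hbj hm4b h3)

end Summit.HodgeConjecture.HodgeConjecture.Cruxes.H413.F0P3cDyRamBeta2ConesOffRowCOfPieces

end
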